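import Literature.MathematicalPhysics.KineticTheory.TaggedSphereContactTrace
import Literature.MathematicalPhysics.KineticTheory.HardSphereMildBBGKY
import HarnessLib

/-!
# The bookkeeping levels of the one-step BBGKY hierarchy for BGSR's marginals
(Bodineau–Gallagher–Saint-Raymond, Invent. Math. 203 (2016) = arXiv:1305.3397v2, §3.1 (3.3)–(3.5)
p. 9 and (4.3) p. 11; Cercignani–Illner–Pulvirenti 1994 §4.3 (4.3.9)–(4.3.10); trunk T-KINETIC,
topic MathematicalPhysics/KineticTheory; a reduction layer for the named fact
`Literature.MathematicalPhysics.KineticTheory.bgsr_linearBoltzmannApprox` of `TaggedSphereDiffusion`.)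

`TaggedSphereContactTrace.bgsr_linearBoltzmannApprox_of_H1` reduces BGSR's Theorem 2.2 (2.9)
(`bgsr_linearBoltzmannApprox`) — and `bodineau_gallagher_saintRaymond_linear_of_H1` its `α = 1`
form, fact (c) — to the one-step integrated BBGKY hierarchy (H1) for the honest marginals
`f_N^{(k)}(t) = bgsrMarginalFamily … k t` of the `N + 1` hard spheres along the regularised
flows, asked at EVERY level `k : ℕ`:
`f^{(k)}(t) = S_k(t) f^{(k)}(0) + ∫_0^t S_k(t - τ) C_{k,k+1} f^{(k+1)}(τ) dτ` a.e.
(`S_k`, `C_{k,k+1}` the transport and the outgoing collision operator of `hsHierarchyModel … (N+1)`).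
Only the levels `1 ≤ k ≤ N` carry dynamics (CIP 1994 Thm 4.3.1 is stated for `1 ≤ s ≤ N - 1`
tagged spheres of `N`; the window analysis of `HardSphereMildBBGKY` is for a tagged block of
`k ≥ 1` spheres and `m ≥ 1` untagged ones). This file settles the remaining, bookkeeping, levels
once and for all and records the corresponding sharper reductions:

* `outBbgkyOp_level_zero` — the collision operator vanishes at level `0` (empty sum; the levels
  `k ≥ N + 1`, prefactor `N + 1 - k = 0`, are `outBbgkyOp_eq_zero_of_le` of
  `HardSphereHierarchyModel`);
* `bgsr_oneStep_of_lt` — levels `k > N + 1`: both sides vanish (`bgsrMarginalFamily_eq_zero_of_lt`);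
* `bgsr_oneStep_top` — level `k = N + 1`: the top marginal is the transported datum itself
  (`nthMarginal_self_apply`), i.e. the Liouville equation in mild form, and `C_{N+1,N+2} = 0`;
* `bgsr_oneStep_level_zero` — level `0`: the `0`-th marginal is the total mass
  (`nthMarginal_zero_apply`), conserved because the regularised flow preserves Lebesgue measure
  (`measurePreserving_regFlow_volume`) and its good set, and `C_{0,1} = 0`;
* `bgsr_oneStep_of_physicalLevels` — (H1) at the levels `1 ≤ k ≤ N` implies (H1) at every level;
* `bgsr_linearBoltzmannApprox_of_H1_phys`, `bgsr_seriesFamily_ae_eq_of_H1_phys`,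
  `bodineau_gallagher_saintRaymond_linear_of_H1_phys` — the reductions of
  `TaggedSphereContactTrace` with (H1) asked only at the physical levels `1 ≤ k ≤ N`.

Theorems only; no definition and no named fact is introduced.

## References

* T. Bodineau, I. Gallagher, L. Saint-Raymond, *The Brownian motion as the limit of a
  deterministic system of hard-spheres*, Invent. Math. 203 (2016) 493–553, arXiv:1305.3397v2,
  §3.1 p. 9, (4.3) p. 11.
* C. Cercignani, R. Illner, M. Pulvirenti, *The Mathematical Theory of Dilute Gases*, Springer
  (1994), §4.3, Thm 4.3.1.
-/

open MeasureTheory MeasureTheory.Measure Metric Real Set Filter Function Topology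
open scoped ENNReal
open Literature.Analysis.FluidPDE

namespace Literature.MathematicalPhysics.KineticTheory

noncomputable section

set_option synthInstance.maxSize 1024

variable {d : Type*} [Fintype d]

/-! ## §1. The collision operator at the bookkeeping levels -/

section Op

variable {X : Type*} (G : Geometry d X) (ε : ℝ)

/-- **`C_{0,1} = 0`**: at level `0` the outgoing collision operator is an empty sum (the levels
`s ≥ N`, prefactor `N - s = 0`, are `outBbgkyOp_eq_zero_of_le` of `HardSphereHierarchyModel`).
[folklore] -/
theorem outBbgkyOp_level_zero (N : ℕ) (g : Config (0 + 1) d X → ℝ) :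
    outBbgkyOp G ε N 0 g = 0 := by
  funext Z
  simp [outBbgkyOp]

end Op

/-! ## §2. The bookkeeping levels of (H1) -/

section Levels

variable {ε : ℝ} (hε : 0 < ε) (hε' : ε < 2⁻¹) (N : ℕ) (β : ℝ) (ρ₀ : UnitAddTorus d → ℝ)

include hε hε' in
/-- The good set of the regularised flow is invariant in both directions: `Φ_t z` is good iff `z`
is (forward by `mapsTo_regFlow_good`; conversely `Φ_t` is the identity off the good set).
[folklore] -/
theorem regFlow_mem_good_iff {n : ℕ} (t : ℝ) (z : Config n d (UnitAddTorus d)) :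
    Alexander.regFlow (Torus.geometry d) ε t z ∈ Alexander.good (Torus.geometry d) ε ↔
      z ∈ Alexander.good (Torus.geometry d) ε := by
  refine ⟨fun h => ?_, fun hz => Alexander.mapsTo_regFlow_good hε hε' t hz⟩
  by_contra hz
  rw [Alexander.regFlow_of_not_mem hz] at h
  exact hz h

/-- **Levels above the top**: for `k > N + 1` both sides of the one-step identity vanish.
[folklore] -/
theorem bgsr_oneStep_of_lt {k : ℕ} (hk : N + 1 < k) (t : ℝ) (Z : Config k d (UnitAddTorus d)) :
    bgsrMarginalFamily hε hε' N β ρ₀ k t Z =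
      (hsHierarchyModel (d := d) hε hε' (N + 1)).transport k t (bgsrMarginalFamily hε hε' N β ρ₀ k 0) Z +
        ∫ τ in (0 : ℝ)..t, (hsHierarchyModel (d := d) hε hε' (N + 1)).transport k (t - τ)
          ((hsHierarchyModel (d := d) hε hε' (N + 1)).op k (bgsrMarginalFamily hε hε' N β ρ₀ (k + 1) τ)) Z := by
  have hop : ∀ τ, (hsHierarchyModel (d := d) hε hε' (N + 1)).op k (bgsrMarginalFamily hε hε' N β ρ₀ (k + 1) τ) = 0 :=
    fun τ => by rw [hsHierarchyModel_op]; exact outBbgkyOp_eq_zero_of_le hk.le _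
  simp only [hop, hsHierarchyModel_transport_apply, bgsrMarginalFamily_eq_zero_of_lt hε hε' N β ρ₀ hk,
    Pi.zero_apply, intervalIntegral.integral_zero, add_zero]

/-- **The top level `k = N + 1` (the Liouville equation in mild form)**: the top marginal is the
transported datum `1_{good} f_N^0 ∘ Φ_{-t}` itself (`nthMarginal_self_apply`), which is its own
transport by the group law of the regularised flow and the invariance of the good set, and
`C_{N+1,N+2} = 0`. [cite: BodineauGallagherSaintRaymondInvent2016, §3.1 (3.2) p. 9] -/
theorem bgsr_oneStep_top (t : ℝ) (Z : Config (N + 1) d (UnitAddTorus d)) :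
    bgsrMarginalFamily hε hε' N β ρ₀ (N + 1) t Z =
      (hsHierarchyModel (d := d) hε hε' (N + 1)).transport (N + 1) t (bgsrMarginalFamily hε hε' N β ρ₀ (N + 1) 0) Z +
        ∫ τ in (0 : ℝ)..t, (hsHierarchyModel (d := d) hε hε' (N + 1)).transport (N + 1) (t - τ)
          ((hsHierarchyModel (d := d) hε hε' (N + 1)).op (N + 1) (bgsrMarginalFamily hε hε' N β ρ₀ (N + 1 + 1) τ)) Z := by
  have hop : ∀ τ, (hsHierarchyModel (d := d) hε hε' (N + 1)).op (N + 1)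
      (bgsrMarginalFamily hε hε' N β ρ₀ (N + 1 + 1) τ) = 0 :=
    fun τ => by rw [hsHierarchyModel_op]; exact outBbgkyOp_eq_zero_of_le le_rfl _
  simp only [hop, Pi.zero_apply, intervalIntegral.integral_zero, add_zero, hsHierarchyModel_transport_apply]
  rw [bgsrMarginalFamily_apply, nthMarginal_self_apply, bgsrMarginalFamily_apply, nthMarginal_self_apply]
  simp only [Alexander.regHardSphereFlow_good]
  by_cases hZ : Z ∈ Alexander.good (Torus.geometry d) ε
  · have hZ' := (regFlow_mem_good_iff hε hε' (-t) Z).2 hZ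
    rw [Set.indicator_of_mem hZ, Set.indicator_of_mem hZ', hsTransport_apply, hsTransport_apply,
      Alexander.regHardSphereFlow_flow, neg_zero, Alexander.regFlow_zero hε hε']
  · have hZ' : Alexander.regFlow (Torus.geometry d) ε (-t) Z ∉ Alexander.good (Torus.geometry d) ε :=
      fun h => hZ ((regFlow_mem_good_iff hε hε' (-t) Z).1 h)
    rw [Set.indicator_of_notMem hZ, Set.indicator_of_notMem hZ']

/-- **Level `0` (conservation of mass)**: the `0`-th marginal is the total mass of the
transported datum (`nthMarginal_zero_apply`), which is that of the datum since the regularised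
flow preserves Lebesgue measure (`measurePreserving_regFlow_volume`) and its good set; and
`C_{0,1} = 0`. [folklore] -/
theorem bgsr_oneStep_level_zero (hρ₀m : Measurable ρ₀) (t : ℝ) (Z : Config 0 d (UnitAddTorus d)) :
    bgsrMarginalFamily hε hε' N β ρ₀ 0 t Z =
      (hsHierarchyModel (d := d) hε hε' (N + 1)).transport 0 t (bgsrMarginalFamily hε hε' N β ρ₀ 0 0) Z +
        ∫ τ in (0 : ℝ)..t, (hsHierarchyModel (d := d) hε hε' (N + 1)).transport 0 (t - τ)
          ((hsHierarchyModel (d := d) hε hε' (N + 1)).op 0 (bgsrMarginalFamily hε hε' N β ρ₀ (0 + 1) τ)) Z := by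
  have hop : ∀ τ, (hsHierarchyModel (d := d) hε hε' (N + 1)).op 0 (bgsrMarginalFamily hε hε' N β ρ₀ (0 + 1) τ) = 0 :=
    fun τ => by rw [hsHierarchyModel_op]; exact outBbgkyOp_level_zero _ _ _ _
  simp only [hop, Pi.zero_apply, intervalIntegral.integral_zero, add_zero, hsHierarchyModel_transport_apply]
  rw [bgsrMarginalFamily_apply, nthMarginal_zero_apply, bgsrMarginalFamily_apply, nthMarginal_zero_apply]
  -- both total masses equal `∫ 1_{good} f_N^0`
  set h : Config (N + 1) d (UnitAddTorus d) → ℝ :=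
    (Alexander.good (Torus.geometry d) ε).indicator (bgsrInitialDensity ε N β ρ₀) with hh
  have hhm : Measurable h :=
    (measurable_bgsrInitialDensity hρ₀m ε N β).indicator
      (Alexander.regHardSphereFlow (d := d) hε hε' (N + 1)).measurableSet_good
  have hpt : ∀ (u : ℝ) (z : Config (N + 1) d (UnitAddTorus d)),
      (Alexander.regHardSphereFlow (d := d) hε hε' (N + 1)).good.indicator
          (hsTransport (Alexander.regHardSphereFlow (d := d) hε hε' (N + 1)) u (bgsrInitialDensity ε N β ρ₀)) z =
        h (Alexander.regFlow (Torus.geometry d) ε (-u) z) := by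
    intro u z
    simp only [hh, Alexander.regHardSphereFlow_good]
    by_cases hz : z ∈ Alexander.good (Torus.geometry d) ε
    · have hz' := (regFlow_mem_good_iff hε hε' (-u) z).2 hz
      rw [Set.indicator_of_mem hz, Set.indicator_of_mem hz', hsTransport_apply, Alexander.regHardSphereFlow_flow]
    · have hz' : Alexander.regFlow (Torus.geometry d) ε (-u) z ∉ Alexander.good (Torus.geometry d) ε :=
        fun h => hz ((regFlow_mem_good_iff hε hε' (-u) z).1 h)
      rw [Set.indicator_of_notMem hz, Set.indicator_of_notMem hz']
  have hint : ∀ u : ℝ, ∫ z, h (Alexander.regFlow (Torus.geometry d) ε (-u) z) = ∫ z, h z := by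
    intro u
    have hmp := measurePreserving_regFlow_volume (d := d) hε hε' (N := N + 1) (-u)
    rw [← integral_map hmp.measurable.aemeasurable hhm.aestronglyMeasurable, hmp.map_eq]
  simp_rw [hpt]
  rw [hint t, hint 0]

/-- **(H1) at the physical levels implies (H1) at every level.** If the one-step integrated
BBGKY identity holds a.e. at the levels `1 ≤ k ≤ N` (the tagged block and at least one untagged
sphere), it holds a.e. at every `k : ℕ`: levels `0`, `N + 1` and `> N + 1` are
`bgsr_oneStep_level_zero`, `bgsr_oneStep_top`, `bgsr_oneStep_of_lt` (at every point).
[cite: BodineauGallagherSaintRaymondInvent2016, (4.3) p. 11] -/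
theorem bgsr_oneStep_of_physicalLevels (hρ₀m : Measurable ρ₀)
    (hphys : ∀ (k : ℕ), 1 ≤ k → k ≤ N → ∀ (t : ℝ), 0 ≤ t → ∀ᵐ Z : Config k d (UnitAddTorus d),
      bgsrMarginalFamily hε hε' N β ρ₀ k t Z =
        (hsHierarchyModel (d := d) hε hε' (N + 1)).transport k t (bgsrMarginalFamily hε hε' N β ρ₀ k 0) Z +
          ∫ τ in (0 : ℝ)..t, (hsHierarchyModel (d := d) hε hε' (N + 1)).transport k (t - τ)
            ((hsHierarchyModel (d := d) hε hε' (N + 1)).op k (bgsrMarginalFamily hε hε' N β ρ₀ (k + 1) τ)) Z)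
    (k : ℕ) (t : ℝ) (ht : 0 ≤ t) :
    ∀ᵐ Z : Config k d (UnitAddTorus d),
      bgsrMarginalFamily hε hε' N β ρ₀ k t Z =
        (hsHierarchyModel (d := d) hε hε' (N + 1)).transport k t (bgsrMarginalFamily hε hε' N β ρ₀ k 0) Z +
          ∫ τ in (0 : ℝ)..t, (hsHierarchyModel (d := d) hε hε' (N + 1)).transport k (t - τ)
            ((hsHierarchyModel (d := d) hε hε' (N + 1)).op k (bgsrMarginalFamily hε hε' N β ρ₀ (k + 1) τ)) Z := by
  rcases Nat.eq_zero_or_pos k with rfl | hk1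
  · exact ae_of_all _ fun Z => bgsr_oneStep_level_zero hε hε' N β ρ₀ hρ₀m t Z
  rcases le_or_gt k N with hkN | hNk
  · exact hphys k hk1 hkN t ht
  rcases (Nat.succ_le_of_lt hNk).eq_or_lt with hkeq | hklt
  · subst hkeq
    exact ae_of_all _ fun Z => bgsr_oneStep_top hε hε' N β ρ₀ t Z
  · exact ae_of_all _ fun Z => bgsr_oneStep_of_lt hε hε' N β ρ₀ hklt t Z

/-- **(S) from (H1) at the physical levels**: the iterated Duhamel formula up to null sets for
BGSR's marginals (`bgsr_seriesFamily_ae_eq_of_H1`) with (H1) asked only for `1 ≤ k ≤ N`.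
[cite: BodineauGallagherSaintRaymondInvent2016, §3.1 Remark 3.1 p. 9; (4.3) p. 11] -/
theorem bgsr_seriesFamily_ae_eq_of_H1_phys (hd : 2 ≤ Fintype.card d) (hβ : 0 < β) (hρ₀m : Measurable ρ₀) {R : ℝ}
    (hρ₀0 : ∀ x, 0 ≤ ρ₀ x) (hR : ∀ x, ρ₀ x ≤ R) (hN : (N : ℝ) * (2 * ε) ^ Fintype.card d ≤ 2⁻¹)
    (hphys : ∀ (k : ℕ), 1 ≤ k → k ≤ N → ∀ (t : ℝ), 0 ≤ t → ∀ᵐ Z : Config k d (UnitAddTorus d),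
      bgsrMarginalFamily hε hε' N β ρ₀ k t Z =
        (hsHierarchyModel (d := d) hε hε' (N + 1)).transport k t (bgsrMarginalFamily hε hε' N β ρ₀ k 0) Z +
          ∫ τ in (0 : ℝ)..t, (hsHierarchyModel (d := d) hε hε' (N + 1)).transport k (t - τ)
            ((hsHierarchyModel (d := d) hε hε' (N + 1)).op k (bgsrMarginalFamily hε hε' N β ρ₀ (k + 1) τ)) Z)
    (s : ℕ) {t : ℝ} (ht : 0 ≤ t) :
    (hsHierarchyModel (d := d) hε hε' (N + 1)).seriesFamily (N + 1)
        (fun k => bgsrMarginalFamily hε hε' N β ρ₀ k 0) s t =ᵐ[volume]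
      bgsrMarginalFamily hε hε' N β ρ₀ s t :=
  bgsr_seriesFamily_ae_eq_of_H1 hε hε' N β ρ₀ hd hβ hρ₀m hρ₀0 hR hN
    (bgsr_oneStep_of_physicalLevels hε hε' N β ρ₀ hρ₀m hphys) s ht

end Levels

/-! ## §3. The named facts from (H1) at the physical levels -/

/-- **BGSR Theorem 2.2 (2.9) from the one-step BBGKY hierarchy at the physical levels.**
`bgsr_linearBoltzmannApprox_of_H1` with (H1) asked only at the levels `1 ≤ k ≤ N` (the
bookkeeping levels being `bgsr_oneStep_of_physicalLevels`): in the regime `d ≥ 2`,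
`0 < ε < 1/2`, `N(2ε)^d ≤ 1/2`, `β > 0`, `ρ⁰` continuous with `0 ≤ ρ⁰ ≤ R`, `∫ ρ⁰ = 1`, the
hypothesis is the integrated BBGKY hierarchy of CIP 1994 Thm 4.3.1 / BGSR (4.3) for the honest
marginals of the `N + 1` hard spheres, one level at a time, almost everywhere.
[cite: BodineauGallagherSaintRaymondInvent2016, Thm 2.2 (2.9) p. 7; (4.3) p. 11] -/
theorem bgsr_linearBoltzmannApprox_of_H1_phys [DecidableEq d]
    (hH1 : 2 ≤ Fintype.card d → ∀ (N : ℕ) (ε : ℝ) (hε : 0 < ε) (hε' : ε < 2⁻¹),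
      (N : ℝ) * (2 * ε) ^ Fintype.card d ≤ 2⁻¹ →
      ∀ (β : ℝ), 0 < β → ∀ (R : ℝ) (ρ₀ : UnitAddTorus d → ℝ), Continuous ρ₀ → (∀ x, 0 ≤ ρ₀ x) →
      (∀ x, ρ₀ x ≤ R) → ∫ x, ρ₀ x = 1 →
        ∀ (k : ℕ), 1 ≤ k → k ≤ N → ∀ (t : ℝ), 0 ≤ t → ∀ᵐ Z : Config k d (UnitAddTorus d),
          bgsrMarginalFamily hε hε' N β ρ₀ k t Z =
            (hsHierarchyModel (d := d) hε hε' (N + 1)).transport k t (bgsrMarginalFamily hε hε' N β ρ₀ k 0) Z +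
              ∫ τ in (0 : ℝ)..t, (hsHierarchyModel (d := d) hε hε' (N + 1)).transport k (t - τ)
                ((hsHierarchyModel (d := d) hε hε' (N + 1)).op k (bgsrMarginalFamily hε hε' N β ρ₀ (k + 1) τ)) Z) :
    bgsr_linearBoltzmannApprox (d := d) :=
  bgsr_linearBoltzmannApprox_of_H1 fun hd N ε hε hε' hN β hβ R ρ₀ hc h0 hR h1 =>
    bgsr_oneStep_of_physicalLevels hε hε' N β ρ₀ hc.measurable (hH1 hd N ε hε hε' hN β hβ R ρ₀ hc h0 hR h1)

/-- **Fact (c) `bodineau_gallagher_saintRaymond_linear` from the one-step BBGKY hierarchy at the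
physical levels**: `bodineau_gallagher_saintRaymond_linear_of_H1` with (H1) asked only at the
levels `1 ≤ k ≤ N`. [cite: BodineauGallagherSaintRaymondInvent2016, Thm 2.2 p. 7; (4.3) p. 11] -/
theorem bodineau_gallagher_saintRaymond_linear_of_H1_phys [DecidableEq d]
    (hH1 : 2 ≤ Fintype.card d → ∀ (N : ℕ) (ε : ℝ) (hε : 0 < ε) (hε' : ε < 2⁻¹),
      (N : ℝ) * (2 * ε) ^ Fintype.card d ≤ 2⁻¹ →
      ∀ (β : ℝ), 0 < β → ∀ (R : ℝ) (ρ₀ : UnitAddTorus d → ℝ), Continuous ρ₀ → (∀ x, 0 ≤ ρ₀ x) →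
      (∀ x, ρ₀ x ≤ R) → ∫ x, ρ₀ x = 1 →
        ∀ (k : ℕ), 1 ≤ k → k ≤ N → ∀ (t : ℝ), 0 ≤ t → ∀ᵐ Z : Config k d (UnitAddTorus d),
          bgsrMarginalFamily hε hε' N β ρ₀ k t Z =
            (hsHierarchyModel (d := d) hε hε' (N + 1)).transport k t (bgsrMarginalFamily hε hε' N β ρ₀ k 0) Z +
              ∫ τ in (0 : ℝ)..t, (hsHierarchyModel (d := d) hε hε' (N + 1)).transport k (t - τ)
                ((hsHierarchyModel (d := d) hε hε' (N + 1)).op k (bgsrMarginalFamily hε hε' N β ρ₀ (k + 1) τ)) Z) :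
    bodineau_gallagher_saintRaymond_linear (d := d) :=
  bodineau_gallagher_saintRaymond_linear_of_H1 fun hd N ε hε hε' hN β hβ R ρ₀ hc h0 hR h1 =>
    bgsr_oneStep_of_physicalLevels hε hε' N β ρ₀ hc.measurable (hH1 hd N ε hε hε' hN β hβ R ρ₀ hc h0 hR h1)

end

end Literature.MathematicalPhysics.KineticTheory
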